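import Literature.NumberTheory.EllipticCurves.McCallum1991.HigherLevelKolyvaginClasses
import Literature.NumberTheory.EllipticCurves.KummerSelmerStructure
import Literature.NumberTheory.GaloisRepresentations.LocalGlobalCohomology
import HarnessLib

/-!
# Jetchev 2008, §5.2–5.3 (printed) = §6.2–6.3 (arXiv): core vertices of the Kummer Selmer
# structure on `E[p^m]` and their existence (printed Prop. 5.3 = arXiv Prop. 6.4)

D. Jetchev, *Global divisibility of Heegner points and Tamagawa numbers*, Compos. Math. **144**
(2008) 811–826 (doi:10.1112/S0010437X08003497; bib `Jetchev2008`). Two texts are cited below with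
line locators: the held arXiv text `paper:arxiv-math_0703431` (chunks `arXiv pNNNN Lnn`; arXiv
numbering Prop. 6.4, Thm. 6.3, Lemma 6.1, Prop. 4.7, Thm. 5.1, Lemma 5.2) and the printed version
of record, URL-read as `paper:url-36a580584b69` (chunk `url p000k` = printed page `810 + k`; print
numbering Prop. 5.3, Thm. 5.2, Lemma 5.1, Prop. 4.4, Thm. 3.3, Lemma 3.4); the full concordance
is in the module docstring of the sibling `Jetchev2008/HeegnerPointGlobalDivisibility.lean`.

Typed for the cell `bsd-jet` (run/shared/lean/pub/bsd-jet/, T1 JET of the BSD rank ≤ 1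
literature → partition programme; seat `bsd-jet-lit-ty`; road K = the kernel discharge of the
reading binders `JET.JetchevDivisibilityCarrierNe` ∕ `…CarrierMult` ∕ `…CarrierAdd`, sheet
`HOME/sheets/PV2-J6-KERNEL.md` §2, stub **S8**). The abstract kernel theorem
`Summit.BirchSwinnertonDyer.Rank1Residual.JET.Section6.tamagawaExponent_le_mInfty_of_coreVertices`
takes printed Prop. 5.3 as its hypothesis `h64 : ∀ k c, m c + k ≤ M c → ∃ c', Core k c' ∧
k + m c ≤ M c' ∧ m c' ≤ m c` for an abstract predicate `Core`; this file supplies, as DEFINITIONS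
with bodies, the printed objects behind `Core` (the transverse condition at a Kolyvagin prime,
§3.1.2; the Selmer module `H_{𝓕(c)}` of the Kummer structure modified to the transverse condition
on `c`, §3.3.1/§3.4.1; "core vertex for `m`", §5.2) and, as ONE named fact (`def … : Prop`,
D-0014), printed Prop. 5.3 itself, in the vocabulary of the road-K siblings
(`McCallum1991/HigherLevelKolyvaginClasses.lean`: `KolyvaginHeegnerData`, `derivedPoint`,
`Zhang2014.IsKolyvaginPrime` ∕ `kolyvaginIndex` ∕ `levelIndex`, `conjAct`) and of the tree's
Selmer-structure layer (`WeierstrassCurve.torsionGaloisModule` ∕ `kummerSelmerStructure`,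
`galoisCohomology.localization` ∕ `res`). HONEST FRAMING (programme §HONESTY, verbatim): «no
tranche here proves BSD; ARM L moves the LITERAL column of an r ≤ 1 census into the
kernel-proved-modulo-named-print column». This file moves no class and carries the printed
Hypothesis (∗) (`p ∤ N`); typed ≠ proved ≠ endorsed.

## The printed statements (verbatim, with locators)

* **Hypothesis (∗)**, p. 812 [url p0002 L2–L4]: *"We have `p ∤ 2N` and the extension `ℚ(E[p])/ℚ`
  has Galois group isomorphic to `GL₂(𝔽_p)`, that is, the mod `p` Galois representation
  `ρ_{E,p} : Gal(ℚ̄/ℚ) → GL(E[p])` is surjective."* (arXiv p0003 L32–L36: "odd prime `p`",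
  "`p ∤ N`"). Setting, p. 811 [url p0001 L15–L24]: `E/ℚ` of conductor `N`, `−D` a Heegner
  discriminant (all prime factors of `N` split in `K = ℚ(√−D)`), *"`φ : X₀(N) → E` a fixed modular
  parametrization"* (arXiv: "optimal"; print drops optimality), `y_K = Tr_{H/K}(φ(x_1))`;
  §4.1.4, p. 818 [url p0008 L37–L47]: *"For what follows, we assume Hypothesis (∗). Let `m'(c)` be
  the largest positive integer such that `P_c ∈ p^{m'(c)}E(K[c])`. If `P_c` is torsion then
  `m'(c) = ∞`. Define … `m(c) = m'(c)` if `m'(c) ≤ M(c)`, `∞` otherwise. … Note that `P_1 = y_K`,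
  so (under our assumptions) `m₀ = m'(1) = ord_p[E(K) : ℤy_K]` is finite"* — i.e. `y_K` of infinite
  order is standing (it is in the statement of the printed Thm. 1.1, p. 812 [url p0002 L26]).
* **Definition 2.1**, p. 813 [url p0003 L36–L43]: *"We call a rational prime `ℓ` a Kolyvagin
  prime relative to `E`, `K` and `p` if `ℓ` is inert in `K` and `p` divides both the `ℓ`th
  coefficient `a_ℓ` of the modular form `f` associated to `E` and `ℓ+1` … let `Λ¹_m` be the set of
  all `ℓ ∈ Λ¹`, such that `p^m ∣ (a_ℓ, ℓ+1)`"*; §4.1.2, p. 818 [url p0008 L9–L17]: *"let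
  `M(ℓ) = ord_p(a_ℓ, ℓ+1)` … `Λ^r` the set of all square-free products of exactly `r` Kolyvagin
  primes and let `Λ = ⋃_r Λ^r` (by convention, `Λ⁰ = {1}`). For each `c ∈ Λ` define
  `M(c) = min_{ℓ∣c} M(ℓ)` … `Λ^r_m = {c ∈ Λ^r : M(c) ≥ m}`. We also set `Λ_m = ⋃_r Λ^r_m`."*
* **§3.1**, pp. 813–814 [url p0003 L44 – p0004 L26]: *"Fix a positive integer `m`. By a local
  condition at a finite place `v` we mean a subgroup of the cohomology group `H¹(K_v, E[p^m])`. …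
  Kummer local condition: … `H¹_Kum(K_v, E[p^m])` … the image of the local Kummer map
  `δ_v : E(K_v)/p^m E(K_v) ↪ H¹(K_v, E[p^m])`."* **§3.1.2**, p. 814 [url p0004 L28–L37]: *"For a
  Kolyvagin prime `ℓ ∈ Λ¹_m` let `λ` be the unique prime of `K` lying above `ℓ`. Let `K[ℓ]_λ` be the
  completion of `K[ℓ]` at the place below the place corresponding to the fixed embedding
  `ι_λ : K̄ ↪ K̄_λ`. Transverse local condition: we define this as
  `H¹_tr(K_λ, E[p^m]) := ker{H¹(K_λ, E[p^m]) → H¹(K[ℓ]_λ, E[p^m])}`."*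
* **§3.2.1–3.2.2**, p. 815 [url p0005 L35–L50]: *"A Selmer structure `𝓕` on `E[p^m]` consists of
  a choice of a local condition `H¹_𝓕(K_v, E[p^m]) ⊆ H¹(K_v, E[p^m])` for each place `v` of `K` …
  `H¹_𝓕(K, E[p^m]) := Ker{H¹(K, E[p^m]) → ⨁_v H¹(K_v, E[p^m])/H¹_𝓕(K_v, E[p^m])}`, where the sum
  is taken over all places `v` of `K`."* **§3.3.1**, p. 816 [url p0006 L53–L59]: *"the standard
  Kummer Selmer structure `𝓕` on `E[p^m]` … `H¹_𝓕(K_v, E[p^m]) := H¹_Kum(K_v, E[p^m])` for every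
  `v`"*. **§3.4.1**, p. 816 [url p0006 L67–L85]: *"Let `𝓕` be a Selmer structure on `E[p^m]` and
  `a, b, c` be relatively prime integers, such that `abc ∈ Λ_m`. The modified Selmer structure
  `𝓕^a_b(c)` is the structure whose local conditions are obtained from those of `𝓕` by simply
  replacing them at the places `v ∣ abc` as follows: if `v ∣ c`, then
  `H¹_{𝓕^a_b(c)}(K_v, E[p^m]) = H¹_tr(K_v, E[p^m])`; if `v ∣ a`, then … `= H¹(K_v, E[p^m])`; if
  `v ∣ b`, then … `= 0`. If `a`, `b` or `c` equals `1`, we simply omit it from the notation"*.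
* **§5.2**, p. 821 [url p0011 L32–L48]: *"Let `m` be an integer. For clarity, we denote each
  Selmer module `H¹_{𝓖(c)}(K, E[p^m])` simply by `H_{𝓖(c)}` … Following the terminology of
  [MR04], we define a core vertex for `m` and for the Kummer Selmer structure `𝓕` to be any
  conductor `c ∈ Λ_m`, such that either `Inv H⁺_{𝓕(c)} = (m)` and `Inv H⁻_{𝓕(c)} = ()`, or
  `Inv H⁺_{𝓕(c)} = ()` and `Inv H⁻_{𝓕(c)} = (m)`."* (arXiv §6.2, p0015 L33–L48, writes `= 0`
  for `= ()`.) Here `H^±` are *"the `±`-eigenspaces for complex conjugation"* (Thm. 3.3, p. 816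
  [url p0006 L30–L31]; §3.2.2: the Selmer modules are `Gal(K/ℚ)`-stable) and `Inv` the sequence of
  invariants (elementary divisors) of a finite `ℤ/p^mℤ`-module: `Inv H = (m)` says `H ≅ ℤ/p^mℤ`,
  `Inv H = ()` says `H = 0`.
* **Proposition 5.3**, p. 823 [url p0013 L2–L3] (= arXiv **Prop. 6.4**, p0016 L35–L37), verbatim:
  *"Let `c ∈ Λ` satisfy `m(c) + m ≤ M(c)`. There exists a core vertex `c' ∈ Λ_{m+m(c)}`, such that
  `m(c') ≤ m(c)`."* — proved in print (pp. 823–824 [url p0013 L4 – p0014 L21]; arXiv p0016 L39 –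
  p0017 L3) from Lemma 5.1 (Čebotarev, [McC91, Cor. 3.2] — the tree's
  `McCallum1991.cor32_eigenclasses_infinite_primes_localOrder`), the lozenge Lemma 3.4 (iii)/(iv),
  the comparison Prop. 4.4 (the tree's `McCallum1991.prop44_localOrder_kolyvaginClass_mul_eq`) and
  the self-duality of `𝓕`, by adjoining primes `ℓ₁, …, ℓ_s ∈ Λ¹_{M(c)}` to `c` one at a time. The
  paper calls it *"The most difficult part of the proof"* of Thm. 1.1 (p. 822 [url p0012 L99]).
  Its consumer is *"Proof of Theorem 1.1"*, p. 824 [url p0014 L23–L36].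

## The Lean definitions (bodies; no new notation, no instances)

Throughout `W/ℚ` is a Weierstrass model, `E/K = W.baseChange K`, `n : ℤ` a level (`n = p^m`),
`ρ = (W.baseChange K).torsionGaloisModule n` the discrete `Γ_K`-module `E[n]`
(`GeomPointsGaloisModule.lean`), so that `H¹(K, E[n]) = galoisCohomology ρ 1 =
galH1Torsion (W.baseChange K) n` (definitionally, `galH1Torsion_baseChange_eq`), with
localisations `galoisCohomology.localization ρ v 1 : H¹(K, E[n]) →+ H¹(K_v, E[n])` at the
places `v : Place K` and restriction `galoisCohomology.res ρ L 1 : H¹(K, E[n]) →+ H¹(L, E[n])` to an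
extension `L/K` (`LocalGlobalCohomology.lean`, `GaloisCohomology.lean`). The ring class field
`K[ℓ] = ringClassField K ι ℓ ⊆ ℂ` (`HeegnerPointsOfConductor.lean`) is a `K`-algebra; that it is a
number field is taken as an instance binder `[∀ k, NumberField (ringClassField K ι k)]` (true:
`finiteDimensional_and_isGalois_ringClassField`; the same device as the sibling
`HeegnerPointsIdentityComponent.lean`).

* `transverseKer W K ι n ℓ ≤ H¹(K, E[n])` — the classes `x` whose restriction to `K[ℓ]` is locally
  trivial at EVERY place `w` of `K[ℓ]` above `ℓ`: `loc_w (res_{K[ℓ]/K} x) = 0`. This is the GLOBAL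
  rendering of the printed transverse condition at the unique prime `λ` of `K` above the inert
  `ℓ`: `loc_λ x ∈ H¹_tr(K_λ, E[p^m]) = ker(H¹(K_λ, E[p^m]) → H¹(K[ℓ]_λ, E[p^m]))`, since
  `res_{K[ℓ]_w/K_λ} ∘ loc_λ = loc_w ∘ res_{K[ℓ]/K}` (functoriality of restriction) and the
  completions `K[ℓ]_w`, `w ∣ λ`, are conjugate over `K_λ` under `Gal(K[ℓ]/K)` (print fixes one of
  them through `ι_λ`; for a class defined over `K` the condition does not depend on the choice).
  (The tree's local notion `DiscreteGaloisModule.transverseSubgroup ρ_v L = ker res_{L/K_v}` would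
  need the completion `K[ℓ]_w` as a `K_λ`-algebra; the global form avoids it.)
* `modifiedSelmerGroup W K ι n c ≤ H¹(K, E[n])` — the printed Selmer module `H_{𝓕(c)}` of the
  Kummer Selmer structure `𝓕` (§3.3.1: the Kummer condition at EVERY place; the tree's
  `WeierstrassCurve.kummerSelmerStructure`, whose Selmer group is `Sel⁽ⁿ⁾(E/K)`) modified as in
  §3.4.1 with `a = b = 1`: Kummer condition at every place of `K` not above a prime factor of `c`,
  transverse condition (`transverseKer`) at the prime factors of `c`. For `c = 1` it IS the Selmer
  group of the Kummer structure (`modifiedSelmerGroup_one`, proved).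
* `signPart W K τ n e H = H ∩ ker(τ − e)` and `IsGlobalCoreVertex W K ι τ p m c` — printed §5.2 for the
  conductor `c`, the level `p^m` and an involution `τ` of `K/ℚ` (complex conjugation; its action
  on `H¹(K, E[n])` is the siblings' `conjAct W τ n`, re-typed here as `conjActH1`): with
  `H = H_{𝓕(c)}`, `H^± = H ∩ ker(τ ∓ 1)`, EITHER `H⁺` is cyclic of order `p^m` and `H⁻ = 0`, OR
  `H⁺ = 0` and `H⁻` is cyclic of order `p^m` — the printed `Inv H⁺ = (m)`, `Inv H⁻ = ()` resp. the
  swap. The clause `c ∈ Λ_m` of the printed "core vertex for `m`" is kept as a separate clause in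
  the fact (as the kernel's `Core k c'` and `k + m c ≤ M c'`).

## The named fact and its faithfulness (hypotheses complete; weaker than print where it differs)

`prop53_exists_coreVertex_of_depth_add_le_levelIndex` is printed Prop. 5.3 with: `W/ℚ` globally
minimal, `N = W.conductorNorm ℤ` (the siblings' convention), non-CM and `d_K ∉ {−3, −4}` ADDED (the
standing binders of every road-K sibling: McCallum's / Jetchev's *"`G_ℓ` … cyclic of order
`ℓ + 1`"* presupposes `𝓞_K^× = {±1}`; surjectivity at an odd `p` excludes CM anyway — extra
hypotheses only weaken); `K` imaginary quadratic with the Heegner hypothesis for `N`; `τ ≠ 1` an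
automorphism of `K/ℚ`; Hypothesis (∗) VERBATIM: `p ≠ 2`, `p ∤ N`, `ρ̄_{E,p}` onto MOD `p`
(`HasSurjectiveModNGaloisRep p`, not the `p`-adic tower); a frame `(Dt, β, ι)` at level `N`
(ANY parametrisation — print's "a fixed modular parametrization") and Kolyvagin–Heegner data `d`
(`KolyvaginHeegnerData Dt β ι c`: the printed choices `σ_ℓ`, `S`, `x_c` packaged per conductor);
`y_K = P_1` of infinite order (`d₁`); `m ≥ 1` (§3.1 *"Fix a positive integer `m`"*); `c ∈ Λ`
(`Squarefree c`, every prime factor a Kolyvagin prime — `Zhang2014.IsKolyvaginPrime N W K p ℓ`,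
which spells "inert, `ℓ ∤ N d_K p`, `M(ℓ) ≥ 1`"; `c = 1` allowed); `m(c) = s < ∞`, i.e. `P_c` not
torsion (print's convention `m'(c) = ∞` for torsion `P_c`) and `p^s ∥ P_c` in `E(K[c])`
(`∃ Q, p^s • Q = P_c` and `¬ ∃ Q, p^{s+1} • Q = P_c`); `m(c) + m ≤ M(c)` as
`s + m ≤ Zhang2014.levelIndex W p c` (`M(c) = min_{ℓ∣c} M(ℓ)` in `ℕ∞`, `M(1) = ∞`; then
`m'(c) = s ≤ M(c)` so `m(c) = m'(c) = s` as print requires). CONCLUSION: there are `c' ∈ Λ` and a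
datum `d'` of conductor `c'` with `c' ∈ Λ_{m+s}` (`m + s ≤ M(ℓ')` for every `ℓ' ∣ c'`),
`IsGlobalCoreVertex W K ι τ p m c'`, and `m(c') ≤ m(c)`: `P_{c'}` not torsion and
`¬ ∃ Q, p^{s+1} • Q = P_{c'}` (so `m'(c') ≤ s < M(c')`, `m(c') = m'(c') ≤ s`).
DATA: print fixes ONE system of choices (`σ_ℓ` for all `ℓ ∈ Λ¹`, p. 813; `S`, p. 818) and speaks of
`P_c` for every `c`; the tree packages the choices in a datum per conductor, so the hypothesis is
stated for every datum `d` of conductor `c` and the conclusion for SOME datum `d'` of conductor `c'`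
(print's own choices restricted to `c'` are such a datum). Below `M(c)` the exponent `ord_p P_c`
does not depend on the choices (a change of `S` moves `P_c` inside `p^{M(c)}E(K[c])` by [Gro91,
Prop. 3.6], quoted at p. 818 [url p0008 L48–L49]; a change of generators `σ_ℓ` or of `x_c` acts
through units and `Gal(K[c]/ℚ)`), so the quantification is the reading of print, as in the sibling
`McCallum1991.prop52_exists_conductor_kolyvaginClass_order_eq` ("pairs `(n, d)`"). The printed
proof produces `c'` as a MULTIPLE `c ℓ₁ ⋯ ℓ_s` of `c`; the statement (and this fact) only assert
existence. IMAGE: mod-`p` surjectivity as printed; no `p ∤ d_K` binder (none is printed; cf. the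
Cor. 1.5 sibling's scope note). Size XL (Jetchev's §§3–5: Poitou–Tate on eigenspaces, lozenge
diagrams, Čebotarev, the comparison `φ_λ`); no `_holds`. Nothing here is a theorem of the tree; the
proposition is consumed as a hypothesis (`h64` of the kernel, after the road-K instantiation layer
S1/S2/S10 of sheet PV2-J6-KERNEL identifies `Core`, `m`, `M` with the objects below).

## What this file does NOT vendor (scope)

Printed Thm. 5.2 and Lemma 3.4 are PROVED abstractly in the kernel (`JET.Section6.*`,
`JET.GlobalDuality.*`); Thm. 3.3 = the tree's `poitouTate_selmerStructure_duality` + the kernel's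
sign-by-sign counting; Lemma 5.1 / Prop. 4.4 = the McCallum siblings. The transverse subgroup as a
`SelmerStructure` LOCAL condition (through `K[ℓ]_w` as a `K_λ`-algebra) and its comparison with
`transverseKer` are left to the instantiation layer. -- TODO(general form): `𝓕^a_b(c)` with
`a, b ≠ 1` and the connected variant `𝓕_⌈q⌉(c)` (printed §3.3.2) are not defined here.

## References

* [Jetchev2008] D. Jetchev, Compos. Math. 144 (2008) 811–826: Hypothesis (∗), Thm. 1.1 (p. 812),
  Def. 2.1 (p. 813), §3.1–3.4 (pp. 813–817), §4.1 (p. 818), §5.2, Thm. 5.2 (p. 821), Prop. 5.3 and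
  its proof (pp. 823–824) — printed text `paper:url-36a580584b69`; arXiv:math/0703431
  `paper:arxiv-math_0703431` §6.2–6.3 (p0015–p0017).
* [MazurRubin2004] B. Mazur, K. Rubin, *Kolyvagin systems*, Mem. AMS 799 (2004), Def. 2.1.1,
  §4.1 (core vertices) — cited through Jetchev ("Following the terminology of [MR04]"); not held.
* [GrossLMS1991] B. H. Gross, LMS LN 153 (1991), §3 Prop. 3.6, §4 (4.1). [McCallumLMS1991]
  W. G. McCallum, same volume, Cor. 3.2, Prop. 4.4, §5. [WZhang2014] W. Zhang, Camb. J. Math. 2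
  (2014), Notations (xii) (`M(ℓ)`, `M(n)`).
-/

noncomputable section

open scoped Classical

open WeierstrassCurve NumberField IsDedekindDomain Literature.NumberTheory.EllipticCurves
  Literature.NumberTheory.EllipticCurves.ModularForms Literature.NumberTheory.GaloisRepresentations

namespace Literature.NumberTheory.EllipticCurves.Jetchev2008

section Definitions

variable (W : WeierstrassCurve ℚ) (K : Type) [Field K] [NumberField K] (ι : K →+* ℂ)

/-- `H¹(K, E[n])` of the road-K siblings (`galH1Torsion`, where `kolyvaginClass` and `conjAct`
live) IS `galoisCohomology ((W.baseChange K).torsionGaloisModule n) 1` — definitionally (both are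
Mathlib's continuous `H¹(Γ_K, E(K̄)[n])`). [cite: SilvermanAEC2009, X.§4 (the group H¹(G_{K̄/K}, E[m]) before Thm. X.4.2)] -/
theorem galH1Torsion_baseChange_eq (n : ℤ) :
    galH1Torsion (W.baseChange K) n = galoisCohomology ((W.baseChange K).torsionGaloisModule n) 1 :=
  rfl

/-- The action of an automorphism `τ` of `K/ℚ` (complex conjugation) on `H¹(K, E[n])`, i.e. the
siblings' `conjAct W τ n` (`SelmerGaloisAction.lean`), as an endomorphism of
`galoisCohomology ((W.baseChange K).torsionGaloisModule n) 1` — the same map (`conjActH1_apply`,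
`rfl`), re-typed so that kernels and eigen-subgroups are formed in the Selmer-structure currency.
[cite: Jetchev2008, §3.2.2 (p. 815): "a stable Gal(K/ℚ)-subspace of H¹(K, E[p^m])"] -/
def conjActH1 (τ : K ≃ₐ[ℚ] K) (n : ℤ) :
    galoisCohomology ((W.baseChange K).torsionGaloisModule n) 1 →+
      galoisCohomology ((W.baseChange K).torsionGaloisModule n) 1 :=
  conjAct W τ n

/-- `conjActH1` is `conjAct` (the printed action of `Gal(K/ℚ)` on `H¹(K, E[p^m])`).
[cite: Jetchev2008, §3.2.2 (p. 815)] -/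
@[simp] theorem conjActH1_apply (τ : K ≃ₐ[ℚ] K) (n : ℤ)
    (x : galoisCohomology ((W.baseChange K).torsionGaloisModule n) 1) :
    conjActH1 W K τ n x = conjAct W τ n x :=
  rfl

/-- **The transverse condition at a Kolyvagin prime `ℓ`, global rendering** (Jetchev 2008,
printed §3.1.2, p. 814: *"`H¹_tr(K_λ, E[p^m]) := ker{H¹(K_λ, E[p^m]) → H¹(K[ℓ]_λ, E[p^m])}`"*, `λ`
the unique prime of `K` above the inert `ℓ`, `K[ℓ]_λ` the completion of the ring class field
`K[ℓ]` at a place above `λ`): the subgroup of `H¹(K, E[n])` of the classes `x` with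
`loc_w (res_{K[ℓ]/K} x) = 0` for every finite place `w` of `K[ℓ] = ringClassField K ι ℓ` above `ℓ`
— equivalently (functoriality of restriction; the `K[ℓ]_w` are conjugate over `K_λ`)
`loc_λ x ∈ H¹_tr(K_λ, E[n])`. See the module docstring for the comparison with the tree's local
`DiscreteGaloisModule.transverseSubgroup`.
[cite: Jetchev2008, §3.1.2 (p. 814; arXiv §4.2 p0009 L136 ff.)] -/
def transverseKer (n : ℤ) (ℓ : ℕ) [NumberField (ringClassField K ι ℓ)] :
    AddSubgroup (galoisCohomology ((W.baseChange K).torsionGaloisModule n) 1) :=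
  ⨅ w ∈ {w : HeightOneSpectrum (𝓞 (ringClassField K ι ℓ)) |
      (ℓ : 𝓞 (ringClassField K ι ℓ)) ∈ w.asIdeal},
    ((galoisCohomology.localization
          (((W.baseChange K).torsionGaloisModule n).restrictField (ringClassField K ι ℓ))
          (Sum.inr w) 1).comp
      (galoisCohomology.res ((W.baseChange K).torsionGaloisModule n) (ringClassField K ι ℓ) 1)).ker

/-- Membership in `transverseKer`: the restriction to `K[ℓ]` dies at every place of `K[ℓ]` above
`ℓ`. [cite: Jetchev2008, §3.1.2 (p. 814)] -/
theorem mem_transverseKer_iff (n : ℤ) (ℓ : ℕ) [NumberField (ringClassField K ι ℓ)]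
    (x : galoisCohomology ((W.baseChange K).torsionGaloisModule n) 1) :
    x ∈ transverseKer W K ι n ℓ ↔
      ∀ w : HeightOneSpectrum (𝓞 (ringClassField K ι ℓ)),
        (ℓ : 𝓞 (ringClassField K ι ℓ)) ∈ w.asIdeal →
        galoisCohomology.localization
            (((W.baseChange K).torsionGaloisModule n).restrictField (ringClassField K ι ℓ))
            (Sum.inr w) 1
          (galoisCohomology.res ((W.baseChange K).torsionGaloisModule n)
            (ringClassField K ι ℓ) 1 x) = 0 := by
  simp only [transverseKer, AddSubgroup.mem_iInf, Set.mem_setOf_eq, AddMonoidHom.mem_ker,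
    AddMonoidHom.coe_comp, Function.comp_apply]

/-- A place `v` of `K` **lies above** the rational prime `ℓ`: `v` is finite and `ℓ ∈ 𝔭_v` (print:
*"let `λ` be the unique prime of `K` lying above `ℓ`"*, the places *"`v ∣ abc`"* of §3.4.1).
[cite: Jetchev2008, §3.1.2 (p. 814) and §3.4.1 (p. 816)] -/
def PlaceOver (v : Place K) (ℓ : ℕ) : Prop :=
  ∃ 𝔳 : HeightOneSpectrum (𝓞 K), v = Sum.inr 𝔳 ∧ (ℓ : 𝓞 K) ∈ 𝔳.asIdeal

/-- **The Selmer module `H_{𝓕(c)} = H¹_{𝓕(c)}(K, E[n])` of the Kummer Selmer structure modified to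
the transverse condition at the primes dividing `c`** (Jetchev 2008, printed §3.2.2, §3.3.1 and
§3.4.1 with `a = b = 1`, pp. 815–816: *"`H¹_𝓕(K, E[p^m]) := Ker{H¹(K, E[p^m]) →
⨁_v H¹(K_v, E[p^m])/H¹_𝓕(K_v, E[p^m])}` … the standard Kummer Selmer structure `𝓕` …
`H¹_𝓕(K_v, E[p^m]) := H¹_Kum(K_v, E[p^m])` for every `v` … if `v ∣ c`, then
`H¹_{𝓕(c)}(K_v, E[p^m]) = H¹_tr(K_v, E[p^m])`"*): the classes `x ∈ H¹(K, E[n])` with `loc_v x` in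
the local Kummer condition (`WeierstrassCurve.kummerSelmerStructure`, the image of
`E(K_v)/n → H¹(K_v, E[n])`) at every place `v` of `K` not above a prime factor of `c`, and
`x ∈ transverseKer W K ι n ℓ` for every prime `ℓ ∣ c`. For `c = 1` this is the Selmer group of the
Kummer structure, `Sel⁽ⁿ⁾(E/K)` (`modifiedSelmerGroup_one`).
[cite: Jetchev2008, §3.2.2, §3.3.1, §3.4.1 (pp. 815–816; arXiv §4.3 p0012 L21–L79)] -/
def modifiedSelmerGroup (n : ℤ) (c : ℕ) [∀ k : ℕ, NumberField (ringClassField K ι k)] :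
    AddSubgroup (galoisCohomology ((W.baseChange K).torsionGaloisModule n) 1) :=
  (⨅ v ∈ {v : Place K | ∀ ℓ ∈ c.primeFactors, ¬ PlaceOver K v ℓ},
      ((W.baseChange K).kummerSelmerStructure n v).comap
        (galoisCohomology.localization ((W.baseChange K).torsionGaloisModule n) v 1)) ⊓
    ⨅ ℓ ∈ c.primeFactors, transverseKer W K ι n ℓ

/-- Membership in `H_{𝓕(c)}`: Kummer condition off `c`, transverse condition on `c`.
[cite: Jetchev2008, §3.4.1 (p. 816)] -/
theorem mem_modifiedSelmerGroup_iff (n : ℤ) (c : ℕ) [∀ k : ℕ, NumberField (ringClassField K ι k)]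
    (x : galoisCohomology ((W.baseChange K).torsionGaloisModule n) 1) :
    x ∈ modifiedSelmerGroup W K ι n c ↔
      (∀ v : Place K, (∀ ℓ ∈ c.primeFactors, ¬ PlaceOver K v ℓ) →
        galoisCohomology.localization ((W.baseChange K).torsionGaloisModule n) v 1 x ∈
          (W.baseChange K).kummerSelmerStructure n v) ∧
      ∀ ℓ ∈ c.primeFactors, x ∈ transverseKer W K ι n ℓ := by
  simp only [modifiedSelmerGroup, AddSubgroup.mem_inf, AddSubgroup.mem_iInf, Set.mem_setOf_eq,
    AddSubgroup.mem_comap]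

/-- **`H_{𝓕(1)} = Sel⁽ⁿ⁾(E/K)`**: with no prime to modify, the module is the Selmer group of the
Kummer Selmer structure (printed §3.3.1), i.e. the `n`-Selmer group of `E/K`
(`selmerGroup_eq_selmerGroup_kummerSelmerStructure`). [cite: Jetchev2008, §3.3.1 (p. 816)] -/
theorem modifiedSelmerGroup_one (n : ℤ) [∀ k : ℕ, NumberField (ringClassField K ι k)] :
    modifiedSelmerGroup W K ι n 1 = ((W.baseChange K).kummerSelmerStructure n).selmerGroup := by
  ext x
  rw [mem_modifiedSelmerGroup_iff, DiscreteGaloisModule.SelmerStructure.mem_selmerGroup_iff]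
  simp only [Nat.primeFactors_one, Finset.notMem_empty, IsEmpty.forall_iff, implies_true,
    forall_const, and_true]

/-- The `+1`/`−1` eigen-subgroup of `τ` on `H¹(K, E[n])` cut out inside a subgroup `H`: the
kernel of `conjAct W τ n ∓ id` intersected with `H` (the printed `H^±`; for odd `n` and an
involution `τ`, `H = H⁺ ⊕ H⁻`). [cite: Jetchev2008, §3.2.2 and Thm. 3.3 (pp. 815–816): "the ±-eigenspaces for complex conjugation"] -/
def signPart (τ : K ≃ₐ[ℚ] K) (n : ℤ) (e : ℤ)
    (H : AddSubgroup (galoisCohomology ((W.baseChange K).torsionGaloisModule n) 1)) :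
    AddSubgroup (galoisCohomology ((W.baseChange K).torsionGaloisModule n) 1) :=
  H ⊓ (conjActH1 W K τ n - e • AddMonoidHom.id _).ker

/-- Membership in `signPart`: `x ∈ H` and `τ x = e • x`. [cite: Jetchev2008, Thm. 3.3 (p. 816)] -/
theorem mem_signPart_iff (τ : K ≃ₐ[ℚ] K) (n : ℤ) (e : ℤ)
    (H : AddSubgroup (galoisCohomology ((W.baseChange K).torsionGaloisModule n) 1))
    (x : galoisCohomology ((W.baseChange K).torsionGaloisModule n) 1) :
    x ∈ signPart W K τ n e H ↔ x ∈ H ∧ conjAct W τ n x = e • x := by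
  simp only [signPart, AddSubgroup.mem_inf, AddMonoidHom.mem_ker, AddMonoidHom.sub_apply,
    AddMonoidHom.smul_apply, AddMonoidHom.id_apply, sub_eq_zero, conjActH1_apply]
  exact Iff.rfl

/-- **Core vertex for `m`** (Jetchev 2008, printed §5.2, p. 821, verbatim: *"Following the
terminology of [MR04], we define a core vertex for `m` and for the Kummer Selmer structure `𝓕` to
be any conductor `c ∈ Λ_m`, such that either `Inv H⁺_{𝓕(c)} = (m)` and `Inv H⁻_{𝓕(c)} = ()`, or
`Inv H⁺_{𝓕(c)} = ()` and `Inv H⁻_{𝓕(c)} = (m)`"*, `H^±` the `±`-eigenspaces of complex conjugation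
on `H_{𝓕(c)} = H¹_{𝓕(c)}(K, E[p^m])`): for the conductor `c`, the level `p^m` and an automorphism
`τ` of `K/ℚ` acting on `H¹(K, E[p^m])` through `conjAct W τ (p^m)` (`SelmerGaloisAction.lean`), with
`H = H_{𝓕(c)}`, `H⁺ = H ∩ ker(τ − 1)`, `H⁻ = H ∩ ker(τ + 1)` (`signPart … 1`,
`signPart … (−1)`): EITHER `H⁺` is cyclic of order `p^m` and `H⁻ = 0`, OR `H⁺ = 0` and `H⁻` is
cyclic of order `p^m`. The clause `c ∈ Λ_m` of the printed
definition is NOT part of this predicate (it is stated next to it where used). NAME: the road-K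
vocabulary file `Jetchev2008/SelmerStructures.lean` declares `Jetchev2008.IsCoreVertex W τ p k 𝒯 S`
(`SelmerStructure` level, transverse family `𝒯` a PARAMETER); this is its parameter-free rendering.
[cite: Jetchev2008, §5.2 (p. 821; arXiv §6.2 p0015 L33–L48)]
[cite: MazurRubin2004, §4.1 (the terminology)] -/
def IsGlobalCoreVertex (τ : K ≃ₐ[ℚ] K) (p m c : ℕ) [∀ k : ℕ, NumberField (ringClassField K ι k)] :
    Prop :=
  let n : ℤ := ((p ^ m : ℕ) : ℤ)
  let Hp := signPart W K τ n 1 (modifiedSelmerGroup W K ι n c)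
  let Hm := signPart W K τ n (-1) (modifiedSelmerGroup W K ι n c)
  (IsAddCyclic Hp ∧ Nat.card Hp = p ^ m ∧ Hm = ⊥) ∨ (Hp = ⊥ ∧ IsAddCyclic Hm ∧ Nat.card Hm = p ^ m)

end Definitions

/-- **Jetchev 2008, Proposition 5.3** (Compos. Math. 144 (2008), p. 823; = arXiv:math/0703431
Prop. 6.4), verbatim: *"Let `c ∈ Λ` satisfy `m(c) + m ≤ M(c)`. There exists a core vertex
`c' ∈ Λ_{m+m(c)}`, such that `m(c') ≤ m(c)`."* — under the standing Hypothesis (∗) (*"`p ∤ 2N` and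
… `ρ_{E,p}` … is surjective"*, p. 812), `y_K` of infinite order (p. 818), `m` a positive integer
(§3.1), with `Λ`, `M(c) = min_{ℓ∣c} ord_p(a_ℓ, ℓ+1)`, `Λ_m = {c ∈ Λ : M(c) ≥ m}`,
`P_c = Σ_{s∈S} s D_c y_c ∈ E(K[c])`, `m'(c)` = the exact `p`-divisibility exponent of `P_c`
(`∞` if `P_c` is torsion), `m(c) = m'(c)` if `m'(c) ≤ M(c)` and `∞` otherwise (§4.1.2–4.1.4), and
"core vertex for `m`" as in `IsGlobalCoreVertex` together with `c' ∈ Λ_m` (§5.2). TRANSCRIPTION (module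
docstring, "faithfulness"): binders of the road-K siblings (`W/ℚ` globally minimal without CM,
`N = W.conductorNorm ℤ`, `K` imaginary quadratic with `d_K ∉ {−3, −4}` and the Heegner hypothesis
for `N` — the CM and `d_K` clauses ADDED, weaker), `τ ≠ 1` in `Aut(K/ℚ)` (complex conjugation),
`p ≠ 2`, `p ∤ N`, `ρ̄_{E,p}` onto mod `p`, a frame `(Dt, β, ι)`, ring class fields number fields
(instance binder), `P_1 = y_K` of infinite order; `1 ≤ m`; `c` square-free with Kolyvagin prime
factors (`Zhang2014.IsKolyvaginPrime`), a datum `d` of conductor `c` with `P_c` non-torsion and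
`p^s ∥ P_c`, and `s + m ≤ M(c)` (`Zhang2014.levelIndex`, in `ℕ∞`). CONCLUSION: `∃ c' d'`, `c'`
square-free with Kolyvagin prime factors `ℓ'` all satisfying `m + s ≤ M(ℓ')` (`c' ∈ Λ_{m+m(c)}`),
`IsGlobalCoreVertex W K ι τ p m c'`, `P_{c'}` non-torsion and `¬ p^{s+1} ∣ P_{c'}` (`m(c') ≤ m(c)`).
Size XL; no `_holds`. Consumer: hypothesis `h64` of
`Summit.BirchSwinnertonDyer.Rank1Residual.JET.Section6.tamagawaExponent_le_mInfty_of_coreVertices`.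
[cite: Jetchev2008, Prop. 5.3 (p. 823) = arXiv Prop. 6.4 (p0016 L35–L37), with Hypothesis (*) (p. 812), Def. 2.1 (p. 813), §4.1.2–4.1.4 (p. 818) and §5.2 (p. 821); proof pp. 823–824]
[cite: GrossLMS1991, §3 Prop. 3.6; §4 (4.1)]
[cite: WZhang2014, Notations (xii)] -/
def prop53_exists_coreVertex_of_depth_add_le_levelIndex : Prop :=
  ∀ (W : WeierstrassCurve ℚ) [W.IsElliptic] [W.IsGloballyMinimal] [NeZero (W.conductorNorm ℤ)],
    ¬ W.HasCM →
    ∀ (K : Type) [Field K] [NumberField K], IsImaginaryQuadratic K →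
    NumberField.discr K ≠ -3 → NumberField.discr K ≠ -4 →
    SatisfiesHeegnerHypothesis (W.conductorNorm ℤ) K →
    ∀ (τ : K ≃ₐ[ℚ] K), τ ≠ 1 →
    ∀ (p : ℕ) [Fact p.Prime], p ≠ 2 → ¬ p ∣ W.conductorNorm ℤ →
      W.HasSurjectiveModNGaloisRep p →
    ∀ (Dt : ModularParametrizationData W (W.conductorNorm ℤ)) (β : ℤ) (ι : K →+* ℂ)
      [∀ k : ℕ, NumberField (ringClassField K ι k)]
      (d₁ : KolyvaginHeegnerData Dt β ι 1), ¬ IsOfFinAddOrder d₁.derivedPoint →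
    ∀ (m : ℕ), 1 ≤ m →
    ∀ (c : ℕ) (d : KolyvaginHeegnerData Dt β ι c), Squarefree c →
      (∀ ℓ ∈ c.primeFactors, Zhang2014.IsKolyvaginPrime (W.conductorNorm ℤ) W K p ℓ) →
    ∀ (s : ℕ), ¬ IsOfFinAddOrder d.derivedPoint →
      (∃ Q : (W.baseChange (ringClassField K ι c)).toAffine.Point,
        ((p ^ s : ℕ) : ℤ) • Q = d.derivedPoint) →
      (¬ ∃ Q : (W.baseChange (ringClassField K ι c)).toAffine.Point,
        ((p ^ (s + 1) : ℕ) : ℤ) • Q = d.derivedPoint) →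
      ((s + m : ℕ) : ℕ∞) ≤ Zhang2014.levelIndex W p c →
      ∃ (c' : ℕ) (d' : KolyvaginHeegnerData Dt β ι c'), Squarefree c' ∧
        (∀ ℓ ∈ c'.primeFactors, Zhang2014.IsKolyvaginPrime (W.conductorNorm ℤ) W K p ℓ ∧
          m + s ≤ Zhang2014.kolyvaginIndex W p ℓ) ∧
        IsGlobalCoreVertex W K ι τ p m c' ∧
        ¬ IsOfFinAddOrder d'.derivedPoint ∧
        ¬ ∃ Q : (W.baseChange (ringClassField K ι c')).toAffine.Point,
          ((p ^ (s + 1) : ℕ) : ℤ) • Q = d'.derivedPoint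

/-- The conclusion's level clause in the kernel's `ℕ∞` currency: `c' ∈ Λ_{m+s}` as
`m + s ≤ M(c')` (`Zhang2014.levelIndex`). [cite: WZhang2014, Notations (xii)] -/
theorem natCast_add_le_levelIndex_of_forall {W : WeierstrassCurve ℚ} [W.IsGloballyMinimal]
    {p m s c' : ℕ} (h : ∀ ℓ ∈ c'.primeFactors, m + s ≤ Zhang2014.kolyvaginIndex W p ℓ) :
    ((m + s : ℕ) : ℕ∞) ≤ Zhang2014.levelIndex W p c' :=
  Zhang2014.natCast_le_levelIndex_iff.mpr h

end Literature.NumberTheory.EllipticCurves.Jetchev2008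

end
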